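import Literature.AlgebraicTopology.SingularHomology.SingularChains
import Mathlib.LinearAlgebra.Finsupp.LSum
import Mathlib.LinearAlgebra.Finsupp.Supported
import Mathlib.Topology.Homotopy.Contractible
import HarnessLib

/-!
# Concrete (finitely supported) singular chains and the comparison with Mathlib's

A. Hatcher, *Algebraic Topology*, CUP 2002, §2.1 defines singular `n`-chains as finite formal
sums `∑ᵢ nᵢ σᵢ` of singular simplices. Mathlib's `AlgebraicTopology.singularChainComplexFunctor`
(wrapped as `Literature.singularChainComplex R M X`) realises `Cₙ(X; M)` as an abstract categorical
coproduct `∐_σ M` in `ModuleCat R`, whose elements cannot be manipulated directly. For the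
element-level arguments of §2.1–§3.3 (supports of chains, chains in a subspace, barycentric
subdivision, excision, Mayer–Vietoris, Lemma 3.27, Prop. 3.29) this file introduces the
*concrete* model and proves it is isomorphic to Mathlib's:

* `Literature.csingularSMod R M X`: the simplicial `R`-module `n ↦ (SingularSimplex X n →₀ M)`;
  `Literature.csingularChainComplex R M X` its alternating face map complex, with `n`-chains
  `Literature.CChain M X n = (SingularSimplex X n →₀ M)` *definitionally*, boundary `bd` / `d_single`,
  functoriality `map` / `map_f_single`;
* `Literature.csingularChainComplex.compIso : csingularChainComplex R M X ≅ singularChainComplex R M X`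
  (`single σ m ↦ m • σ`, natural in `X`), and on homology
  `Literature.csingularHomology.compIso : csingularHomology R M X n ≅ singularHomology R M X n`;
  homotopy invariance, `mapIso`, `isoOfHomotopyEquiv`, vanishing for contractible spaces are
  transported from Mathlib / `Literature.AlgebraicTopology.SingularHomology.SingularChains`;
* `Literature.simplicesIn X A n`, `Literature.chainsIn R M X A n` (`Finsupp.supported`): simplices/chains with
  image in `A ⊆ X`, stable under `bd` and push-forward, `chainsIn (A ∩ B) = chainsIn A ⊓ chainsIn B`;
  the carrier `CChain.carrier c` of a chain (compact); `Cₙ(↥A) → Cₙ(X)` is injective with image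
  `chainsIn A` (`mapDomain_val_injective`, `range_lmapDomain_val`).

Everything here is definitions-with-bodies and proved lemmas ([folklore] over Hatcher §2.1);
nothing is asserted.

## Implementation notes

The identification `(csingularChainComplex R M X).X n = ModuleCat.of R (CChain M X n)` and the
comparison with Mathlib's coproduct hold up to unfolding of semireducible definitions
(`ChainComplex.of`, `SSet.chainComplex`); as in
`Mathlib/AlgebraicTopology/SingularHomology/Basic.lean` we set
`backward.isDefEq.respectTransparency false` for this file.

## References

* A. Hatcher, *Algebraic Topology*, CUP 2002, §2.1.
-/

noncomputable section

-- see "Implementation notes" in the module docstring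
set_option backward.isDefEq.respectTransparency false

open CategoryTheory Limits AlgebraicTopology Simplicial Opposite

universe u v

namespace Literature.AlgebraicTopology.SingularHomology

variable (R : Type v) [CommRing R] (M : Type v) [AddCommGroup M] [Module R M]
variable {X Y Z : Type u} [TopologicalSpace X] [TopologicalSpace Y] [TopologicalSpace Z]

variable (X) in
/-- The concrete simplicial `R`-module of singular chains of `X` with coefficients in `M`:
in simplicial degree `n` the free construction `(singular n-simplices of X) →₀ M`, simplicial
operators acting by `Finsupp.mapDomain` (Hatcher 2002, §2.1: `Cₙ(X) = ⊕_σ M`). [folklore] -/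
abbrev csingularSMod : SimplicialObject (ModuleCat.{max u v} R) where
  obj n := ModuleCat.of R ((TopCat.toSSet.obj (TopCat.of X)).obj n →₀ M)
  map θ := ModuleCat.ofHom (Finsupp.lmapDomain M R ((TopCat.toSSet.obj (TopCat.of X)).map θ))
  map_id n := by
    ext v : 4
    simp
  map_comp θ θ' := by
    ext v : 4
    simp

namespace csingularSMod

/-- The morphism of concrete simplicial chain modules induced by a continuous map
(push-forward of simplices, `Finsupp.mapDomain`) (Hatcher 2002, §2.1). [folklore] -/
def map (f : C(X, Y)) : csingularSMod R M X ⟶ csingularSMod R M Y where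
  app n := ModuleCat.ofHom
    (Finsupp.lmapDomain M R ((TopCat.toSSet.map (TopCat.ofHom f)).app n))
  naturality n m θ := by
    dsimp only [csingularSMod]
    apply ModuleCat.hom_ext
    refine Finsupp.lhom_ext (fun σ x => ?_)
    rw [ModuleCat.hom_comp, ModuleCat.hom_comp, LinearMap.comp_apply, LinearMap.comp_apply,
      ModuleCat.hom_ofHom, ModuleCat.hom_ofHom, ModuleCat.hom_ofHom, ModuleCat.hom_ofHom,
      Finsupp.lmapDomain_apply, Finsupp.lmapDomain_apply, Finsupp.lmapDomain_apply,
      Finsupp.lmapDomain_apply, Finsupp.mapDomain_single, Finsupp.mapDomain_single,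
      Finsupp.mapDomain_single, Finsupp.mapDomain_single, NatTrans.naturality_apply]

/-- The face operators of the concrete simplicial module on elementary chains:
`δᵢ (single σ m) = single (σ.face i) m`. [folklore] -/
lemma δ_hom_single {n : ℕ} (i : Fin (n + 2)) (σ : SingularSimplex X (n + 1)) (m : M) :
    ((csingularSMod R M X).δ i).hom (Finsupp.single σ m) = Finsupp.single (σ.face i) m :=
  Finsupp.mapDomain_single


/-- `map` on an elementary chain: `f♯ (m • σ) = m • (f ∘ σ)` (Hatcher 2002, §2.1). [folklore] -/
lemma map_app_hom_single (f : C(X, Y)) {n : ℕ} (σ : SingularSimplex X n) (m : M) :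
    ((map R M f).app (op ⦋n⦌)).hom (Finsupp.single σ m) = Finsupp.single (σ.map f) m :=
  Finsupp.mapDomain_single

/-- `map (id) = 𝟙`. [folklore] -/
lemma map_id : map R M (ContinuousMap.id X) = 𝟙 (csingularSMod R M X) := by
  ext n : 2
  dsimp only [csingularSMod, map]
  refine Finsupp.lhom_ext (fun σ x => ?_)
  rw [NatTrans.id_app, ModuleCat.hom_ofHom, Finsupp.lmapDomain_apply, Finsupp.mapDomain_single]
  change Finsupp.single ((TopCat.toSSet.map (𝟙 (TopCat.of X))).app n σ) x = Finsupp.single σ x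
  rw [CategoryTheory.Functor.map_id]
  rfl

/-- `map (g ∘ f) = map f ≫ map g`. [folklore] -/
lemma map_comp (f : C(X, Y)) (g : C(Y, Z)) :
    map R M (g.comp f) = map R M f ≫ map R M g := by
  ext n : 2
  dsimp only [csingularSMod, map]
  refine Finsupp.lhom_ext (fun σ x => ?_)
  rw [NatTrans.comp_app, ModuleCat.hom_comp, LinearMap.comp_apply, ModuleCat.hom_ofHom,
    ModuleCat.hom_ofHom, ModuleCat.hom_ofHom, Finsupp.lmapDomain_apply, Finsupp.lmapDomain_apply,
    Finsupp.lmapDomain_apply, Finsupp.mapDomain_single, Finsupp.mapDomain_single,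
    Finsupp.mapDomain_single]
  change Finsupp.single ((TopCat.toSSet.map (TopCat.ofHom f ≫ TopCat.ofHom g)).app n σ) x = _
  rw [CategoryTheory.Functor.map_comp]
  rfl

end csingularSMod

/-! ### The concrete singular chain complex -/

variable (X) in
/-- Concrete singular `n`-chains of `X` with coefficients in `M`: finitely supported functions from
singular `n`-simplices to `M` (Hatcher 2002, §2.1, "formal sums `∑ nᵢ σᵢ`"). [folklore] -/
abbrev CChain (n : ℕ) : Type (max u v) := SingularSimplex X n →₀ M

variable (X) in
/-- The concrete singular chain complex `C_•(X; M)`: the alternating face map complex of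
`csingularSMod R M X`; its `n`-chains are `CChain M X n = (SingularSimplex X n →₀ M)`
definitionally (Hatcher 2002, §2.1). [folklore] -/
def csingularChainComplex : ChainComplex (ModuleCat.{max u v} R) ℕ :=
  AlternatingFaceMapComplex.obj (csingularSMod R M X)

namespace csingularChainComplex

variable {R M}

/-- The `n`-chains of the concrete complex are `CChain M X n`, definitionally. [folklore] -/
lemma X_eq (n : ℕ) : (csingularChainComplex R M X).X n = ModuleCat.of R (CChain M X n) := rfl

variable (R) in
/-- The concrete singular boundary `∂ : Cₙ₊₁(X; M) → Cₙ(X; M)` as an `R`-linear map,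
`∂ (m • σ) = ∑ᵢ (-1)ⁱ m • (σ ∘ δᵢ)` (Hatcher 2002, §2.1). [folklore] -/
def bd (n : ℕ) : CChain M X (n + 1) →ₗ[R] CChain M X n :=
  ∑ i : Fin (n + 2), ((-1 : R) ^ (i : ℕ)) • Finsupp.lmapDomain M R (SingularSimplex.face i)

/-- The boundary of an elementary chain (Hatcher 2002, §2.1). [folklore] -/
lemma bd_single {n : ℕ} (σ : SingularSimplex X (n + 1)) (m : M) :
    bd R n (Finsupp.single σ m) =
      ∑ i : Fin (n + 2), ((-1 : R) ^ (i : ℕ)) • Finsupp.single (σ.face i) m := by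
  simp [bd, Finsupp.mapDomain_single]

/-- The differential of the concrete complex is `bd` (Hatcher 2002, §2.1). [folklore] -/
lemma d_eq (n : ℕ) : (csingularChainComplex R M X).d (n + 1) n = ModuleCat.ofHom (bd R n) := by
  dsimp only [csingularChainComplex]
  rw [AlternatingFaceMapComplex.obj_d_eq]
  apply ModuleCat.hom_ext
  refine Finsupp.lhom_ext (fun σ m => ?_)
  rw [ModuleCat.hom_ofHom, bd_single, ModuleCat.hom_sum, LinearMap.coe_sum, Finset.sum_apply]
  refine Finset.sum_congr rfl fun i _ => ?_
  rw [ModuleCat.hom_zsmul, LinearMap.smul_apply, csingularSMod.δ_hom_single,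
    ← Int.cast_smul_eq_zsmul R, Int.cast_pow, Int.cast_neg, Int.cast_one]

/-- The differential of the concrete complex applied to a chain is `bd` (Hatcher 2002, §2.1). [folklore] -/
lemma d_apply (n : ℕ) (c : (csingularChainComplex R M X).X (n + 1)) :
    (csingularChainComplex R M X).d (n + 1) n c = bd R n c := by
  rw [d_eq]
  rfl

/-- The differential on an elementary chain: `∂ (m • σ) = ∑ᵢ (-1)ⁱ m • (σ ∘ δᵢ)`
(Hatcher 2002, §2.1). [folklore] -/
lemma d_single {n : ℕ} (σ : SingularSimplex X (n + 1)) (m : M) :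
    (csingularChainComplex R M X).d (n + 1) n (Finsupp.single σ m) =
      ∑ i : Fin (n + 2), ((-1 : R) ^ (i : ℕ)) • (Finsupp.single (σ.face i) m : CChain M X n) := by
  rw [d_apply, bd_single]

variable (R M) in
/-- The chain map `f♯` of concrete singular chains induced by a continuous map
(Hatcher 2002, §2.1). [folklore] -/
def map (f : C(X, Y)) : csingularChainComplex R M X ⟶ csingularChainComplex R M Y :=
  AlternatingFaceMapComplex.map (csingularSMod.map R M f)

/-- `f♯ (m • σ) = m • (f ∘ σ)` (Hatcher 2002, §2.1). [folklore] -/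
lemma map_f_single (f : C(X, Y)) {n : ℕ} (σ : SingularSimplex X n) (m : M) :
    (map R M f).f n (Finsupp.single σ m) = (Finsupp.single (σ.map f) m : CChain M Y n) :=
  Finsupp.mapDomain_single

/-- `f♯` is `Finsupp.mapDomain (· .map f)` degreewise. [folklore] -/
lemma map_f_apply (f : C(X, Y)) {n : ℕ} (c : (csingularChainComplex R M X).X n) :
    (map R M f).f n c = Finsupp.mapDomain (fun σ : SingularSimplex X n => σ.map f) c := rfl

/-- `𝟙♯ = 𝟙`. [folklore] -/
@[simp]
lemma map_id : map R M (ContinuousMap.id X) = 𝟙 _ := by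
  rw [map, csingularSMod.map_id]
  exact (alternatingFaceMapComplex _).map_id _

/-- `(g ∘ f)♯ = f♯ ≫ g♯`. [folklore] -/
lemma map_comp (f : C(X, Y)) (g : C(Y, Z)) : map R M (g.comp f) = map R M f ≫ map R M g := by
  rw [map, csingularSMod.map_comp]
  exact (alternatingFaceMapComplex _).map_comp _ _


/-! ### Comparison with Mathlib's singular chain complex -/

variable (R M X) in
/-- The comparison map from concrete chains to Mathlib's singular chains in degree `n`:
`Finsupp.single σ m ↦ m • σ` (Hatcher 2002, §2.1, `Cₙ(X) = ⊕_σ M`). [folklore] -/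
def compHom (n : ℕ) : ModuleCat.of R (CChain M X n) ⟶ (singularChainComplex R M X).X n :=
  ModuleCat.ofHom (Finsupp.lsum R fun σ => singularChainComplex.singleₗ (R := R) (M := M) σ)

/-- `compHom (single σ m) = m • σ`. [folklore] -/
lemma compHom_single {n : ℕ} (σ : SingularSimplex X n) (m : M) :
    (compHom R M X n).hom (Finsupp.single σ m) = singularChainComplex.single (R := R) σ m :=
  Finsupp.lsum_single _ _ _ _

variable (R M X) in
/-- The inverse comparison map in degree `n`, defined on the coproduct by `m • σ ↦ single σ m`
(universal property of Mathlib's chains, `SSet.isColimitChainComplexXCofan`). [folklore] -/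
def compInv (n : ℕ) : (singularChainComplex R M X).X n ⟶ ModuleCat.of R (CChain M X n) :=
  Cofan.IsColimit.desc (SSet.isColimitChainComplexXCofan (TopCat.toSSet.obj (TopCat.of X))
      (ModuleCat.of R (ULift.{u} M)) n)
    (fun σ => ModuleCat.ofHom ((Finsupp.lsingle (M := M) (R := R) σ).comp
      ULift.moduleEquiv.toLinearMap))

/-- `compInv (m • σ) = single σ m`. [folklore] -/
lemma compInv_single {n : ℕ} (σ : SingularSimplex X n) (m : M) :
    (compInv R M X n).hom (singularChainComplex.single (R := R) σ m) = Finsupp.single σ m := by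
  have h := Cofan.IsColimit.fac (SSet.isColimitChainComplexXCofan (TopCat.toSSet.obj (TopCat.of X))
    (ModuleCat.of R (ULift.{u} M)) n)
    (fun σ => ModuleCat.ofHom ((Finsupp.lsingle (M := M) (R := R) σ).comp
      ULift.moduleEquiv.toLinearMap)) σ
  have h' := congrArg (fun φ => φ.hom (ULift.up m)) h
  simp only [SSet.chainComplexXCofan, cofan_mk_inj] at h'
  exact h'

/-- `compInv ∘ compHom = id` on concrete chains. [folklore] -/
lemma compHom_compInv (n : ℕ) : compHom R M X n ≫ compInv R M X n = 𝟙 _ := by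
  apply ModuleCat.hom_ext
  refine Finsupp.lhom_ext fun σ m => ?_
  change (compInv R M X n).hom ((compHom R M X n).hom (Finsupp.single σ m)) = Finsupp.single σ m
  rw [compHom_single, compInv_single]

/-- `compHom ∘ compInv = id` on Mathlib's chains. [folklore] -/
lemma compInv_compHom (n : ℕ) : compInv R M X n ≫ compHom R M X n = 𝟙 _ := by
  refine Cofan.IsColimit.hom_ext (SSet.isColimitChainComplexXCofan (TopCat.toSSet.obj (TopCat.of X))
    (ModuleCat.of R (ULift.{u} M)) n) _ _ fun σ => ?_
  erw [Category.comp_id]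
  ext ⟨m⟩
  change (compHom R M X n).hom ((compInv R M X n).hom
    (((TopCat.toSSet.obj (TopCat.of X)).ιChainComplex (R := ModuleCat.of R (ULift.{u} M)) σ).hom
      (ULift.up m))) = _
  rw [← singularChainComplex.single_eq_ιChainComplex, compInv_single, compHom_single]
  rfl

variable (R M X) in
/-- The degree-`n` component of the comparison isomorphism between concrete chains
`(SingularSimplex X n →₀ M)` and Mathlib's singular chains (a coproduct of copies of `ULift M`
indexed by singular simplices): `Finsupp.single σ m ↦ m • σ` (Hatcher 2002, §2.1,
`Cₙ(X) = ⊕_σ M`). [folklore] -/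
def compIsoX (n : ℕ) : ModuleCat.of R (CChain M X n) ≅ (singularChainComplex R M X).X n where
  hom := compHom R M X n
  inv := compInv R M X n
  hom_inv_id := compHom_compInv n
  inv_hom_id := compInv_compHom n

/-- The comparison isomorphism on an elementary chain: `single σ m ↦ m • σ`. [folklore] -/
lemma compIsoX_hom_single {n : ℕ} (σ : SingularSimplex X n) (m : M) :
    (compIsoX R M X n).hom (Finsupp.single σ m) = singularChainComplex.single (R := R) σ m :=
  compHom_single σ m

variable (R M X) in
/-- **The concrete singular chain complex is isomorphic to Mathlib's**, by `single σ m ↦ m • σ`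
in each degree (Hatcher 2002, §2.1: both are `⊕_σ M` with the alternating face differential). [folklore] -/
def compIso : csingularChainComplex R M X ≅ singularChainComplex R M X :=
  HomologicalComplex.Hom.isoOfComponents (fun n => compIsoX R M X n) fun i j hij => by
    obtain rfl : j + 1 = i := hij
    apply ModuleCat.hom_ext
    refine Finsupp.lhom_ext fun σ m => ?_
    change (singularChainComplex R M X).d (j + 1) j ((compIsoX R M X (j + 1)).hom (Finsupp.single σ m)) =
      (compIsoX R M X j).hom ((csingularChainComplex R M X).d (j + 1) j (Finsupp.single σ m))
    rw [compIsoX_hom_single, singularChainComplex.d_single, d_single, map_sum]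
    refine Finset.sum_congr rfl fun k _ => ?_
    rw [map_smul, compIsoX_hom_single]

/-- The comparison isomorphism in degree `n` is `compIsoX`. [folklore] -/
lemma compIso_hom_f (n : ℕ) : (compIso R M X).hom.f n = (compIsoX R M X n).hom := rfl

/-- The comparison isomorphism on an elementary chain. [folklore] -/
lemma compIso_hom_f_single {n : ℕ} (σ : SingularSimplex X n) (m : M) :
    (compIso R M X).hom.f n (Finsupp.single σ m) = singularChainComplex.single (R := R) σ m :=
  compIsoX_hom_single σ m

/-- Naturality of the comparison isomorphism: `f♯ ≫ comp = comp ≫ f♯` (Hatcher 2002, §2.1). [folklore] -/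
lemma map_comp_compIso_hom (f : C(X, Y)) :
    map R M f ≫ (compIso R M Y).hom = (compIso R M X).hom ≫ singularChainComplex.map R M f := by
  ext n : 1
  apply ModuleCat.hom_ext
  refine Finsupp.lhom_ext fun σ m => ?_
  change (compIso R M Y).hom.f n ((map R M f).f n (Finsupp.single σ m)) =
    (singularChainComplex.map R M f).f n ((compIso R M X).hom.f n (Finsupp.single σ m))
  rw [map_f_single, compIso_hom_f_single, compIso_hom_f_single, singularChainComplex.map_f_single]

end csingularChainComplex

/-! ### Concrete singular homology and its comparison with `Literature.AlgebraicTopology.SingularHomology.singularHomology` -/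

variable (X) in
/-- The `n`-th homology of the concrete singular chain complex, `Hₙ(X; M)` computed from
`(SingularSimplex X n →₀ M)` (Hatcher 2002, §2.1). [folklore] -/
abbrev csingularHomology (n : ℕ) : ModuleCat.{max u v} R :=
  (csingularChainComplex R M X).homology n

namespace csingularHomology

/-- The induced map `f_*` on concrete singular homology (Hatcher 2002, §2.1). [folklore] -/
abbrev map (f : C(X, Y)) (n : ℕ) : csingularHomology R M X n ⟶ csingularHomology R M Y n :=
  HomologicalComplex.homologyMap (csingularChainComplex.map R M f) n

/-- `𝟙_* = 𝟙`. [folklore] -/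
@[simp]
lemma map_id (n : ℕ) : map R M (ContinuousMap.id X) n = 𝟙 _ := by
  rw [map, csingularChainComplex.map_id, HomologicalComplex.homologyMap_id]

/-- `(g ∘ f)_* = g_* ∘ f_*`. [folklore] -/
@[reassoc]
lemma map_comp (f : C(X, Y)) (g : C(Y, Z)) (n : ℕ) :
    map R M (g.comp f) n = map R M f n ≫ map R M g n := by
  rw [map, csingularChainComplex.map_comp, HomologicalComplex.homologyMap_comp]

variable (X) in
/-- **Concrete and Mathlib singular homology agree**: `Hₙ` of the comparison isomorphism of
chain complexes `csingularChainComplex.compIso` (Hatcher 2002, §2.1). [folklore] -/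
def compIso (n : ℕ) : csingularHomology R M X n ≅ singularHomology R M X n :=
  (HomologicalComplex.homologyFunctor _ _ n).mapIso (csingularChainComplex.compIso R M X)

/-- Naturality of the homology comparison isomorphism (Hatcher 2002, §2.1). [folklore] -/
@[reassoc]
lemma map_comp_compIso_hom (f : C(X, Y)) (n : ℕ) :
    map R M f n ≫ (compIso R M Y n).hom = (compIso R M X n).hom ≫ singularHomology.map R M f n := by
  change HomologicalComplex.homologyMap _ n ≫ HomologicalComplex.homologyMap _ n =
    HomologicalComplex.homologyMap _ n ≫ HomologicalComplex.homologyMap _ n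
  rw [← HomologicalComplex.homologyMap_comp, ← HomologicalComplex.homologyMap_comp,
    csingularChainComplex.map_comp_compIso_hom]

/-- The concrete `f_*` is conjugate to Mathlib's `f_*` under the comparison isomorphisms. [folklore] -/
lemma map_eq_conj (f : C(X, Y)) (n : ℕ) :
    map R M f n = (compIso R M X n).hom ≫ singularHomology.map R M f n ≫ (compIso R M Y n).inv := by
  rw [← map_comp_compIso_hom_assoc, Iso.hom_inv_id, Category.comp_id]

/-- **Homotopy invariance** for concrete singular homology: homotopic maps induce the same map
(Hatcher 2002, Thm. 2.10; transported from Mathlib's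
`TopCat.Homotopy.congr_homologyMap_singularChainComplexFunctor`). [folklore] -/
lemma map_eq_of_homotopic {f g : C(X, Y)} (h : f.Homotopic g) (n : ℕ) :
    map R M f n = map R M g n := by
  rw [map_eq_conj, map_eq_conj, singularHomology.map_eq_of_homotopic R M h]

/-- A homeomorphism induces an isomorphism on concrete singular homology (Hatcher 2002, §2.1). [folklore] -/
@[simps]
def mapIso (e : X ≃ₜ Y) (n : ℕ) : csingularHomology R M X n ≅ csingularHomology R M Y n where
  hom := map R M e n
  inv := map R M e.symm n
  hom_inv_id := by
    rw [← map_comp]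
    exact (congrArg (map R M · n) (by ext x; exact e.symm_apply_apply x)).trans (map_id R M n)
  inv_hom_id := by
    rw [← map_comp]
    exact (congrArg (map R M · n) (by ext x; exact e.apply_symm_apply x)).trans (map_id R M n)

/-- A homotopy equivalence induces an isomorphism on concrete singular homology
(Hatcher 2002, Cor. 2.11). [folklore] -/
@[simps]
def isoOfHomotopyEquiv (e : ContinuousMap.HomotopyEquiv X Y) (n : ℕ) :
    csingularHomology R M X n ≅ csingularHomology R M Y n where
  hom := map R M e.toFun n
  inv := map R M e.invFun n
  hom_inv_id := by rw [← map_comp, map_eq_of_homotopic R M e.left_inv, map_id]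
  inv_hom_id := by rw [← map_comp, map_eq_of_homotopic R M e.right_inv, map_id]

end csingularHomology

/-- Positive-degree concrete homology of a point-like (subsingleton) space vanishes
(Hatcher 2002, Prop. 2.8). [folklore] -/
theorem isZero_csingularHomology_of_subsingleton [Subsingleton X] {n : ℕ} (hn : n ≠ 0) :
    IsZero (csingularHomology R M X n) :=
  (isZero_singularHomology_of_subsingleton R M hn).of_iso (csingularHomology.compIso R M X n)

/-- Positive-degree concrete homology of a contractible space vanishes (Hatcher 2002, Prop. 2.8
with Cor. 2.11). [folklore] -/
theorem isZero_csingularHomology_of_contractibleSpace [ContractibleSpace X] {n : ℕ} (hn : n ≠ 0) :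
    IsZero (csingularHomology R M X n) := by
  obtain ⟨e⟩ := ContractibleSpace.hequiv X PUnit.{u + 1}
  exact (isZero_csingularHomology_of_subsingleton R M (X := PUnit.{u + 1}) hn).of_iso
    (csingularHomology.isoOfHomotopyEquiv R M e n)

/-! ### Simplices and chains in a subspace; supports -/

namespace SingularSimplex

variable {n : ℕ}

/-- The image `σ(Δⁿ) ⊆ X` of a singular simplex (Hatcher 2002, §2.1, "the image of `σ`"). [folklore] -/
def range (σ : SingularSimplex X n) : Set X := Set.range (toContinuousMap σ)

/-- The image of a singular simplex is compact (`Δⁿ` is compact). [folklore] -/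
lemma isCompact_range (σ : SingularSimplex X n) : IsCompact σ.range :=
  _root_.isCompact_range (toContinuousMap σ).continuous

/-- The image of a singular simplex is nonempty. [folklore] -/
lemma range_nonempty (σ : SingularSimplex X n) : σ.range.Nonempty :=
  Set.range_nonempty _

/-- `toContinuousMap` of a face is the restriction along the coface map `Δⁿ → Δⁿ⁺¹`. [folklore] -/
lemma toContinuousMap_face (i : Fin (n + 2)) (σ : SingularSimplex X (n + 1)) :
    toContinuousMap (σ.face i) =
      (toContinuousMap σ).comp ⟨stdSimplex.map (Fin.succAbove i), stdSimplex.continuous_map _⟩ :=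
  rfl

/-- `toContinuousMap (σ.map f) = f ∘ toContinuousMap σ`. [folklore] -/
lemma toContinuousMap_map (f : C(X, Y)) (σ : SingularSimplex X n) :
    toContinuousMap (σ.map f) = f.comp (toContinuousMap σ) :=
  rfl

/-- The image of a face is contained in the image (Hatcher 2002, §2.1). [folklore] -/
lemma range_face_subset (i : Fin (n + 2)) (σ : SingularSimplex X (n + 1)) :
    (σ.face i).range ⊆ σ.range := by
  rintro _ ⟨t, rfl⟩
  exact ⟨_, rfl⟩

/-- The image of `f ∘ σ` is `f (image of σ)`. [folklore] -/
lemma range_map (f : C(X, Y)) (σ : SingularSimplex X n) : (σ.map f).range = f '' σ.range := by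
  rw [range, toContinuousMap_map, ContinuousMap.coe_comp, Set.range_comp]
  rfl

end SingularSimplex

variable (X) in
/-- The singular `n`-simplices of `X` with image in `A ⊆ X` (Hatcher 2002, §2.1: the simplices of
the subcomplex `Cₙ(A) ⊆ Cₙ(X)`). [folklore] -/
def simplicesIn (A : Set X) (n : ℕ) : Set (SingularSimplex X n) := {σ | σ.range ⊆ A}

/-- Membership in `simplicesIn`. [folklore] -/
@[simp]
lemma mem_simplicesIn {A : Set X} {n : ℕ} (σ : SingularSimplex X n) :
    σ ∈ simplicesIn X A n ↔ σ.range ⊆ A := Iff.rfl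

/-- `simplicesIn` is monotone in the subspace. [folklore] -/
lemma simplicesIn_mono {A B : Set X} (h : A ⊆ B) (n : ℕ) : simplicesIn X A n ⊆ simplicesIn X B n :=
  fun _ hσ => hσ.trans h

/-- Every simplex lies in `univ`. [folklore] -/
@[simp]
lemma simplicesIn_univ (n : ℕ) : simplicesIn X Set.univ n = Set.univ :=
  Set.eq_univ_of_forall fun _ => Set.subset_univ _

/-- Simplices in `A ∩ B` are the simplices in `A` and in `B`. [folklore] -/
lemma simplicesIn_inter (A B : Set X) (n : ℕ) :
    simplicesIn X (A ∩ B) n = simplicesIn X A n ∩ simplicesIn X B n :=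
  Set.ext fun _ => Set.subset_inter_iff

/-- Faces of simplices in `A` are in `A`. [folklore] -/
lemma face_mem_simplicesIn {A : Set X} {n : ℕ} {σ : SingularSimplex X (n + 1)}
    (hσ : σ ∈ simplicesIn X A (n + 1)) (i : Fin (n + 2)) : σ.face i ∈ simplicesIn X A n :=
  (SingularSimplex.range_face_subset i σ).trans hσ

/-- `f ∘ σ` lies in `B` if `σ` lies in `A` and `f(A) ⊆ B`. [folklore] -/
lemma map_mem_simplicesIn {A : Set X} {B : Set Y} (f : C(X, Y)) (h : Set.MapsTo f A B) {n : ℕ}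
    {σ : SingularSimplex X n} (hσ : σ ∈ simplicesIn X A n) : σ.map f ∈ simplicesIn Y B n := by
  rw [mem_simplicesIn, SingularSimplex.range_map]
  exact (Set.image_mono hσ).trans h.image_subset

variable (X) in
/-- The submodule `Cₙ(A; M) ⊆ Cₙ(X; M)` of concrete chains supported on simplices with image in
`A` (Hatcher 2002, §2.1, "chains in `A`"): `Finsupp.supported` on `simplicesIn X A n`. [folklore] -/
def chainsIn (A : Set X) (n : ℕ) : Submodule R (CChain M X n) :=
  Finsupp.supported M R (simplicesIn X A n)

/-- Membership in `chainsIn`: all simplices of the chain have image in `A`. [folklore] -/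
lemma mem_chainsIn_iff {A : Set X} {n : ℕ} (c : CChain M X n) :
    c ∈ chainsIn R M X A n ↔ ∀ σ ∈ c.support, σ.range ⊆ A := by
  rw [chainsIn, Finsupp.mem_supported']
  constructor
  · intro h σ hσ
    by_contra hA
    exact (Finsupp.mem_support_iff.mp hσ) (h σ hA)
  · intro h σ hσ
    by_contra hc
    exact hσ (h σ (Finsupp.mem_support_iff.mpr hc))

/-- An elementary chain `m • σ` lies in `Cₙ(A)` when `σ` has image in `A`. [folklore] -/
lemma single_mem_chainsIn {A : Set X} {n : ℕ} {σ : SingularSimplex X n} (hσ : σ.range ⊆ A) (m : M) :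
    Finsupp.single σ m ∈ chainsIn R M X A n :=
  Finsupp.single_mem_supported R m hσ

/-- `chainsIn` is monotone in the subspace. [folklore] -/
lemma chainsIn_mono {A B : Set X} (h : A ⊆ B) (n : ℕ) : chainsIn R M X A n ≤ chainsIn R M X B n :=
  Finsupp.supported_mono (simplicesIn_mono h n)

/-- `Cₙ(X) = ⊤`. [folklore] -/
@[simp]
lemma chainsIn_univ (n : ℕ) : chainsIn R M X Set.univ n = ⊤ := by
  rw [chainsIn, simplicesIn_univ, Finsupp.supported_univ]

/-- `Cₙ(A ∩ B) = Cₙ(A) ⊓ Cₙ(B)` (Hatcher 2002, §2.2). [folklore] -/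
lemma chainsIn_inter (A B : Set X) (n : ℕ) :
    chainsIn R M X (A ∩ B) n = chainsIn R M X A n ⊓ chainsIn R M X B n := by
  rw [chainsIn, simplicesIn_inter, Finsupp.supported_inter]
  rfl

/-- The boundary of a chain in `A` is a chain in `A`: `C_•(A)` is a subcomplex
(Hatcher 2002, §2.1). [folklore] -/
lemma bd_mem_chainsIn {A : Set X} {n : ℕ} {c : CChain M X (n + 1)}
    (hc : c ∈ chainsIn R M X A (n + 1)) : csingularChainComplex.bd R n c ∈ chainsIn R M X A n := by
  rw [← Finsupp.sum_single c, Finsupp.sum, map_sum]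
  refine Submodule.sum_mem _ fun σ hσ => ?_
  rw [csingularChainComplex.bd_single]
  refine Submodule.sum_mem _ fun i _ => Submodule.smul_mem _ _ (single_mem_chainsIn R M ?_ _)
  exact face_mem_simplicesIn ((mem_chainsIn_iff R M c).mp hc σ hσ) i

/-- `f♯` maps `Cₙ(A)` into `Cₙ(B)` when `f(A) ⊆ B` (Hatcher 2002, §2.1, maps of pairs). [folklore] -/
lemma mapDomain_mem_chainsIn {A : Set X} {B : Set Y} (f : C(X, Y)) (h : Set.MapsTo f A B) {n : ℕ}
    {c : CChain M X n} (hc : c ∈ chainsIn R M X A n) :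
    Finsupp.mapDomain (fun σ : SingularSimplex X n => σ.map f) c ∈ chainsIn R M Y B n := by
  rw [← Finsupp.sum_single c, Finsupp.sum, Finsupp.mapDomain_finsetSum]
  refine Submodule.sum_mem _ fun σ hσ => ?_
  rw [Finsupp.mapDomain_single]
  exact single_mem_chainsIn R M (map_mem_simplicesIn f h ((mem_chainsIn_iff R M c).mp hc σ hσ)) _

/-! ### The support (carrier) of a chain -/

namespace CChain

variable {M} {n : ℕ}

/-- The carrier `|c| ⊆ X` of a chain: the union of the images of its simplices
(Hatcher 2002, §2.1 and proof of Prop. 2.21: "the image of a chain is compact"). [folklore] -/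
def carrier (c : CChain M X n) : Set X := ⋃ σ ∈ c.support, σ.range

/-- The carrier of a chain is compact (a finite union of images of simplices). [folklore] -/
lemma isCompact_carrier (c : CChain M X n) : IsCompact (carrier c) :=
  c.support.finite_toSet.isCompact_biUnion fun σ _ => σ.isCompact_range

/-- A chain lies in `Cₙ(A)` iff its carrier is contained in `A`. [folklore] -/
lemma mem_chainsIn_iff_carrier_subset {A : Set X} (c : CChain M X n) :
    c ∈ chainsIn R M X A n ↔ carrier c ⊆ A := by
  rw [mem_chainsIn_iff, carrier, Set.iUnion₂_subset_iff]

/-- The image of every simplex of a chain is contained in its carrier. [folklore] -/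
lemma range_subset_carrier {c : CChain M X n} {σ : SingularSimplex X n} (hσ : σ ∈ c.support) :
    σ.range ⊆ carrier c :=
  Set.subset_biUnion_of_mem (u := fun σ : SingularSimplex X n => σ.range) hσ

/-- Every chain lies in `Cₙ(|c|)`. [folklore] -/
lemma mem_chainsIn_carrier (c : CChain M X n) : c ∈ chainsIn R M X (carrier c) n :=
  (mem_chainsIn_iff_carrier_subset R c).mpr le_rfl

end CChain

/-! ### Chains of a subspace versus chains in a subspace -/

namespace SingularSimplex

variable {n : ℕ}

/-- `toContinuousMap` is injective (it is an equivalence). [folklore] -/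
lemma toContinuousMap_injective : Function.Injective (toContinuousMap (X := X) (n := n)) :=
  toContinuousMap.injective

/-- Push-forward of simplices along an injective map is injective. [folklore] -/
lemma map_injective {f : C(X, Y)} (hf : Function.Injective f) :
    Function.Injective fun σ : SingularSimplex X n => σ.map f := by
  intro σ τ h
  have h' := congrArg toContinuousMap h
  simp only [toContinuousMap_map] at h'
  apply toContinuousMap_injective
  ext t
  exact hf (congrFun (congrArg DFunLike.coe h') t)

/-- A singular simplex of `X` with image in `A` as a singular simplex of the subspace `A`
(Hatcher 2002, §2.1: `Cₙ(A)` "is" the chains of `X` with image in `A`). [folklore] -/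
def codRestrict (σ : SingularSimplex X n) (A : Set X) (h : σ.range ⊆ A) : SingularSimplex A n :=
  toContinuousMap.symm ⟨Set.codRestrict (toContinuousMap σ) A fun t => h ⟨t, rfl⟩,
    (toContinuousMap σ).continuous.codRestrict _⟩

/-- Restricting the codomain and including back gives the original simplex. [folklore] -/
@[simp]
lemma codRestrict_map_val (σ : SingularSimplex X n) (A : Set X) (h : σ.range ⊆ A) :
    (σ.codRestrict A h).map ⟨Subtype.val, continuous_subtype_val⟩ = σ := by
  apply toContinuousMap_injective
  rw [toContinuousMap_map, codRestrict, Equiv.apply_symm_apply]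
  rfl

/-- A simplex of the subspace `A`, included into `X`, has image in `A`. [folklore] -/
lemma range_map_val_subset (A : Set X) (τ : SingularSimplex A n) :
    (τ.map ⟨Subtype.val, continuous_subtype_val⟩).range ⊆ A := by
  rw [range_map]
  rintro _ ⟨x, _, rfl⟩
  exact x.2

/-- The simplices of `X` coming from the subspace `A` are exactly those with image in `A`. [folklore] -/
lemma range_map_val (A : Set X) :
    Set.range (fun τ : SingularSimplex A n => τ.map ⟨Subtype.val, continuous_subtype_val⟩) =
      simplicesIn X A n := by
  ext σ
  constructor
  · rintro ⟨τ, rfl⟩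
    exact range_map_val_subset A τ
  · intro h
    exact ⟨σ.codRestrict A h, codRestrict_map_val σ A h⟩

end SingularSimplex

/-- The inclusion of chains `Cₙ(↥A; M) → Cₙ(X; M)` is injective (Hatcher 2002, §2.1). [folklore] -/
lemma mapDomain_val_injective (A : Set X) (n : ℕ) :
    Function.Injective (Finsupp.mapDomain (M := M)
      fun τ : SingularSimplex A n => τ.map ⟨Subtype.val, continuous_subtype_val⟩) :=
  Finsupp.mapDomain_injective (SingularSimplex.map_injective Subtype.val_injective)

/-- The image of `Cₙ(↥A; M) → Cₙ(X; M)` is exactly the submodule `chainsIn A` of chains with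
carrier in `A` (Hatcher 2002, §2.1). [folklore] -/
lemma range_lmapDomain_val (A : Set X) (n : ℕ) :
    LinearMap.range (Finsupp.lmapDomain M R
      fun τ : SingularSimplex A n => τ.map ⟨Subtype.val, continuous_subtype_val⟩) =
      chainsIn R M X A n := by
  rw [LinearMap.range_eq_map, ← Finsupp.supported_univ, Finsupp.lmapDomain_supported,
    Set.image_univ, SingularSimplex.range_map_val]
  rfl

end Literature.AlgebraicTopology.SingularHomology

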